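import Summits.QuantumFields.YangMills.Theorems.FluctuationComparisonRegPrIntLS2BetaCurlBudgetEngine
import Summits.QuantumFields.YangMills.Theorems.FluctuationComparisonRegPrIntLS2BetaReadCellSelection
import Summits.QuantumFields.YangMills.Theorems.FluctuationComparisonRegPrIntLS2BetaRelPlaqCurlJunction
import HarnessLib

/-!
# S2β · (SCT″-c)₁ THE c₁ BUDGET CORE, FILE 2 of 2 — «Σ_t L^t·c₁(t) AGAINST THE PURSE's REL AND THE SOURCE ENERGIES»: the c₁ TEXT v2 of record VERBATIM on the left,
# reindexed `t ↦ K−J−1−t`, read through ✓`exists_sel_sq_pi_norm_trunc_le` into FILE 1's engine over orientations, the finest data docked to the purse's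
# `REL = Σ_p (1 − reTr((P_{U₀}p)⁻¹·P_{e^ζU₀}p))` by ✓`sum_dist1_relPlaq_sq_le_four_mul` (JNC-0: level-0 data in GROUP currency)

Cell `ym3-torus` (YM ladder rung R3 = continuum `SU(2)` Yang–Mills on the three-torus at fixed lattice data — a RUNG: NOT d = 4, NOT infinite volume, NOT a mass gap,
NOT Clay).  Width seat «width 10» `ym3-torus-px10` (gen 26); crux `stmt-QuantumFields-20520`, LINE g18-1 S2β; the c₁ BUDGET CORE (architect px17 g22 2026-08-31T21:24:01Z NAMED;
px16 g24 KEEP 21:38:00Z).  `--kind proof --supports stmt-QuantumFields-20520 --as helper`, count-neutral, DEFINITION-FREE (0 `def`, 0 `instance`, 0 `notation`, 0 `sorry`,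
default heartbeats).

WHAT IS PROVED (sorry-free).  ★★★`curlBudget_core` — at FIXED data (`F`, `J ≤ K`, `U₀`, `ζ`, any read thickness `θr : ℕ`, any `Cst ≥ 0`, any C–S weights `w > 0` with `Σ_{j∈Icc 1 n} w_j⁻¹ ≤ W`): for nonneg
per-orientation families `ρ_{μν} i : Site (F.P K) i → ℝ`, `src_{μν}`, `ε ≥ 0` with
  (DOM)  `dist1((P_{Ū^n U₀} p)⁻¹·P_{Ū^n(e^ζU₀)} p) ≤ ρ_{p.μ p.ν} n (p.src)` for `n < K − J` (the TEXT's integrand; `Ū = blockAvg ℰp` iterated),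
  (DOM₀) `ρ_{p.μ p.ν} 0 (p.src) ≤ dist1((P_{U₀} p)⁻¹·P_{e^ζU₀} p)` (finest data IS the group-currency size — JNC-0),
  (ROWS) ✓`rows_rescale`'s `hrow` VERBATIM per `μ < ν`: `ρ_{μν}(i+1)(y′) ≤ (1 + ε i)·|Idx|⁻¹·Σ_a ρ_{μν} i (…blockSite∕shiftN…) + src_{μν}(i+1)(y′)` (`i < K − J`),
  (EPS)  `2·Σ_{j<K−J} ε j ≤ Eε`,   (SRC) `Σ_{j∈Icc 1 (K−J)} w j·L^{K−J−1−j}·Σ_{μ,ν}Σ_c src_{μν} j c² ≤ Bsrc`: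
  **`Σ_{t<K−J} L^t·c₁(t) ≤ e^{Eε}·(2·Cst·κ²νC_b)·(4·L⁻¹·(L^{K−J}·REL) + W·Bsrc)`**, `κ²νC_b = (5³)²·((2(θr+2)+1)³·6)·(2(L³−1)∕(L³−3))` (K-UNIFORM, `L` and `θr` only);
★★`curlBudget_core_two_pow` — the same at `w_j = 2^j`, `W = 1`.  The right side is the station's `hSCT₁` currency: `L^{K−J}·REL ≤ purse`, and a source letter
`Bsrc := Csrc·e^{c_cΣθ}·purse + βsrc·S′` makes it `C₁·e^{c_cΣθ}·purse + β₁·S′` with `C₁ = e^{Eε}·2Cst·κ²νC_b·(4∕L + W·Csrc)`, `β₁ = e^{Eε}·2Cst·κ²νC_b·W·βsrc`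
(the station-prefix edition is a successor file once the source letter's text is signed — px13 g28 ∕ px16 g24 ∕ px12 g26 ∕ px21 g25 (iii)).

WHERE THE HYPOTHESES COME FROM (the c₁ half of the sup chain's gap list, by name): (ROWS)+(EPS) = rows v2 (px13 g28, (β-3)′ ✓p833442∕B₁∕B₂∕C ✓p835xxx; `ε i` = the local-curl-priced
OSC part, (RSP-Σ) px12 ✓p834849∕✓p834939 bounds `Σε`), (SRC) = the source energies ((BKG)-linear ✓p832546, OSC remainder via OSC-LIFT ✓p835228, curved `q′M²κ` via FILE C, cubic),
(DOM)∕(DOM₀) = the rows author's choice of currency (linearised curl + ✓p832898∕✓p833305 junctions above level 0, group currency AT level 0).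

HONEST SCOPE.  Finite bookkeeping over LANDED letters (px13 g27 ✓p832878 ∕ px16 g23 ✓p833397 engine, ✓p835103 rescale, ✓p833783 selection, ✓p832898 junction, ✓`card_filter_mem_ends_le`);
nothing of Bałaban's renormalisation-group analysis is asserted or proved ([Balaban1985Averaging] (19)–(20) p.21, Prop. 4 (128)–(135) pp.37–38 and [Balaban1987RG1] (0.1)–(0.4),
(0.11) pp.251–253 are the printed recursion these rows transcribe); ROWS v2 (px13 g28), the ε-letter ((RSP-Σ), px12), the source energies ((BKG)-linear, OSC remainder,
curved pieces — px13), the κ-ratio letter (px16 g24), (iii) (px21), the SUPPLIER KNIT (LEAD w3), NC-ROW′, (ST‴)∕LOC‴, h3 are HYPOTHESES or others'; GAP♯∘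
(`stub_uniformFibreGapOrbit`, registry `Lines/semiclassical_s2beta.lean` 3732b7df UNTOUCHED, 0∕5), S2β, the five registered stubs, crux 20520, 19936, 19200 and
`YM3TorusSU2` are NOT proved; no registered stub is closed; rung R3 = SU(2) YM₃ on T³ at fixed lattice data — NOT d = 4, NOT infinite volume, NOT a mass gap, NOT Clay;
the Yang–Mills mass gap is NOT proved.
-/

set_option autoImplicit false

noncomputable section

open Finset

namespace Summit.QuantumFields.YangMills.Theorems.FluctuationComparisonRegPrIntLS2BetaCurlBudget

open Literature.MathematicalPhysics.QuantumFieldTheory.Balaban1983to89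
open Literature.MathematicalPhysics.QuantumFieldTheory.Balaban1983to89.T4Continuum
open Literature.MathematicalPhysics.QuantumFieldTheory.Balaban1983to89.T3ContinuumYM3Torus
open Literature.MathematicalPhysics.QuantumFieldTheory.Balaban1983to89.T3LevelShift
open Literature.MathematicalPhysics.QuantumFieldTheory.Balaban1983to89.T3UnitLawDensityEML (ℰp)
open Literature.MathematicalPhysics.QuantumFieldTheory.Balaban1983to89.T4HaarSU2ExpChart (expPoint)
open Literature.MathematicalPhysics.QuantumFieldTheory.Balaban1983to89.BlockAveraging (Idx blockAvg)
open Literature.MathematicalPhysics.QuantumFieldTheory.Balaban1983to89.B10Eq47AxialChi (shiftN)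
open Literature.MathematicalPhysics.QuantumFieldTheory.Balaban1983to89.B14.Eq22Determines (blockIter)
open Literature.MathematicalPhysics.QuantumFieldTheory.Balaban1983to89.B10Eq27TorusAxialLog (rel)
open Summit.QuantumFields.YangMills.Theorems.FluctuationComparisonRegPrIntLS2BetaReadCellSelection (exists_sel_sq_pi_norm_trunc_le)
open Summit.QuantumFields.YangMills.Theorems.FluctuationComparisonRegPrIntLS2BetaRelPlaqCurlJunction (sum_dist1_relPlaq_sq_le_four_mul)
open Summit.QuantumFields.YangMills.Theorems.FluctuationComparisonRegPrIntLS2BetaCurlBudgetEngine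
  (sum_plaq_eq_sum_ite sum_Icc_inv_two_pow_le_one readCell_nonempty kernelConst_nonneg weighted_orient_sum_le)

variable (F : T3Family)

/-! ## §3 The c₁ budget core for fixed data -/

/-- ★★★ **THE c₁ BUDGET CORE, FIXED DATA** (`F`, `J ≤ K`, `U₀`, `ζ`; c₁ TEXT v2 of record, px16 g23 ∕ architect 2026-08-31T19:51Z, VERBATIM as the summand):
for nonneg per-orientation families `ρ_{μν}, src_{μν}` and `ε ≥ 0` such that (DOM) `ρ` dominates the TEXT's integrand — the LEFT-relative GROUP-currency relative plaquette size
`dist1 ((P_{Ū^n U₀} p)⁻¹·P_{Ū^n (e^ζU₀)} p)` — at every level `n < K − J`, (DOM₀) at level `0` it IS that size (JNC-0: finest data in group currency), (ROWS) the `(1+ε)`-rows of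
✓`rows_rescale` hold for `μ < ν`, (EPS) `2Σ_{j<K−J} ε_j ≤ Eε` and (SRC) the `w`-weighted (ST)-weighted source energy is `≤ Bsrc`:
`Σ_{t<K−J} L^t·c₁(t) ≤ e^{Eε}·2·Cst·κ²νC_b·(4·L⁻¹·(L^{K−J}·REL) + W·Bsrc)`, `REL = Σ_p (1 − reTr((P_{U₀}p)⁻¹ P_{e^ζU₀} p))` the purse's relative-plaquette term
(reindex `t ↦ K−J−1−t`, ✓`exists_sel_sq_pi_norm_trunc_le`, §2, ✓`sum_dist1_relPlaq_sq_le_four_mul`).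
[cite: Balaban1985Averaging, (19)-(20) p.21, Prop. 4 (128)-(135) pp.37-38; Balaban1987RG1, (0.1)-(0.4), (0.11) pp.251-253] -/
theorem curlBudget_core {J K : ℕ} (hJK : J ≤ K) (θr : ℕ) (Cst : ℝ) (hCst : 0 ≤ Cst)
    (U₀ : GaugeField (F.P K) 0 (Matrix.specialUnitaryGroup (Fin 2) ℂ)) (ζ : PBond (F.P K) 0 → EuclideanSpace ℝ (Fin 3))
    (w : ℕ → ℝ) (hw : ∀ j, 0 < w j) (W : ℝ) (hW : ∀ n, ∑ j ∈ Finset.Icc 1 n, (w j)⁻¹ ≤ W)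
    (ρ src : Fin (F.P K).d → Fin (F.P K).d → (i : ℕ) → Site (F.P K) i → ℝ) (ε : ℕ → ℝ)
    (hρ : ∀ μ ν i x, 0 ≤ ρ μ ν i x) (hsrc : ∀ μ ν i x, 0 ≤ src μ ν i x) (hε : ∀ j, 0 ≤ ε j)
    (hdom : ∀ n, n < K - J → ∀ p : Plaq (F.P K) n,
      dist1 ((GaugeField.plaqHol (Averaging.iter (fun k => BlockAveraging.blockAvg (P := F.P K) (j := k) ℰp) n U₀) p)⁻¹ *
          GaugeField.plaqHol (Averaging.iter (fun k => BlockAveraging.blockAvg (P := F.P K) (j := k) ℰp) n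
            (fun ℓ => expPoint (ζ ℓ) * U₀ ℓ : GaugeField (F.P K) 0 (Matrix.specialUnitaryGroup (Fin 2) ℂ))) p) ≤ ρ p.μ p.ν n p.src)
    (hdom0 : ∀ p : Plaq (F.P K) 0, ρ p.μ p.ν 0 p.src ≤
      dist1 ((GaugeField.plaqHol U₀ p)⁻¹ * GaugeField.plaqHol (fun ℓ => expPoint (ζ ℓ) * U₀ ℓ : GaugeField (F.P K) 0 (Matrix.specialUnitaryGroup (Fin 2) ℂ)) p))
    (hrow : ∀ μ ν, μ < ν → ∀ i, i < K - J → ∀ y' : Site (F.P K) (i + 1),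
        ρ μ ν (i + 1) y' ≤ (1 + ε i) * ((Fintype.card (Idx (F.P K)) : ℝ)⁻¹ *
            ∑ a ∈ (Finset.univ : Finset (Idx (F.P K))) ×ˢ (Finset.range (F.P K).L ×ˢ Finset.range (F.P K).L),
              ρ μ ν i (shiftN (shiftN (Site.blockSite y' a.1.1) μ a.2.1) ν a.2.2)) +
          src μ ν (i + 1) y')
    (Eε : ℝ) (hEε : 2 * ∑ j ∈ Finset.range (K - J), ε j ≤ Eε) (Bsrc : ℝ)
    (hBsrc : ∑ j ∈ Finset.Icc 1 (K - J), w j * (F.L : ℝ) ^ (K - J - 1 - j) *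
        ∑ μ : Fin (F.P K).d, ∑ ν : Fin (F.P K).d, ∑ c : Site (F.P K) j, src μ ν j c ^ 2 ≤ Bsrc) :
    ∑ t ∈ Finset.range (K - J), (F.L : ℝ) ^ t * (fun t => Cst * ∑ B : PBond (F.P J) 0,
      ‖(fun p : Plaq (F.P K) (K - J - 1 - t) =>
        if ∃ z₀ : Site (F.P K) 0, (blockIter (K - J) z₀ = (bondShift (F.sitesPerDir_eq (m := F.m) (K := J) (j := 0) (m' := F.m) (K' := K) (j' := K - J) (by omega)) B).src ∨
            blockIter (K - J) z₀ = (bondShift (F.sitesPerDir_eq (m := F.m) (K := J) (j := 0) (m' := F.m) (K' := K) (j' := K - J) (by omega)) B).tgt) ∧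
            ∀ κ, (rel (blockIter (K - J - 1 - t) z₀) p.src κ).natAbs ≤ θr
        then dist1 ((GaugeField.plaqHol (Averaging.iter (fun k => BlockAveraging.blockAvg (P := F.P K) (j := k) ℰp) (K - J - 1 - t) U₀) p)⁻¹ *
          GaugeField.plaqHol (Averaging.iter (fun k => BlockAveraging.blockAvg (P := F.P K) (j := k) ℰp) (K - J - 1 - t)
            (fun ℓ => expPoint (ζ ℓ) * U₀ ℓ : GaugeField (F.P K) 0 (Matrix.specialUnitaryGroup (Fin 2) ℂ))) p)
        else 0)‖ ^ 2) t ≤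
      Real.exp Eε * (2 * Cst * (((5 ^ (F.P K).d : ℕ) : ℝ) ^ 2 * (((2 * (θr + 2) + 1) ^ (F.P K).d * 6 : ℕ) : ℝ) *
              (2 * ((((F.P K).L ^ (F.P K).d : ℕ) : ℝ) - 1) / ((((F.P K).L ^ (F.P K).d : ℕ) : ℝ) - 3)))) *
        (4 * (F.L : ℝ)⁻¹ * ((F.L : ℝ) ^ (K - J) * ∑ p : Plaq (F.P K) 0,
                  (1 - reTr ((GaugeField.plaqHol U₀ p)⁻¹ * GaugeField.plaqHol (fun ℓ => expPoint (ζ ℓ) * U₀ ℓ : GaugeField (F.P K) 0 (Matrix.specialUnitaryGroup (Fin 2) ℂ)) p))) + W * Bsrc) := by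
  have hL1 : (1 : ℝ) ≤ (F.L : ℝ) := by exact_mod_cast F.hL.2.le
  have hL0 : (0 : ℝ) < (F.L : ℝ) := lt_of_lt_of_le zero_lt_one hL1
  have hKL : 0 ≤ (((5 ^ (F.P K).d : ℕ) : ℝ) ^ 2 * (((2 * (θr + 2) + 1) ^ (F.P K).d * 6 : ℕ) : ℝ) *
              (2 * ((((F.P K).L ^ (F.P K).d : ℕ) : ℝ) - 1) / ((((F.P K).L ^ (F.P K).d : ℕ) : ℝ) - 3))) := kernelConst_nonneg F K θr
  have hWnn : 0 ≤ W := le_trans (by simp) (hW 0)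
  have hBnn : 0 ≤ Bsrc :=
    le_trans (Finset.sum_nonneg fun j _ => mul_nonneg (mul_nonneg (hw j).le (pow_nonneg hL0.le _))
      (Finset.sum_nonneg fun μ _ => Finset.sum_nonneg fun ν _ => Finset.sum_nonneg fun c _ => sq_nonneg _)) hBsrc
  -- the finest junction (JNC-0): `Σ_p dist1² ≤ 4·REL`, hence `REL ≥ 0`
  have hJ0 := sum_dist1_relPlaq_sq_le_four_mul (P := F.P K) (fun ℓ => expPoint (ζ ℓ) * U₀ ℓ : GaugeField (F.P K) 0 (Matrix.specialUnitaryGroup (Fin 2) ℂ)) U₀ Finset.univ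
  have hREL : 0 ≤ ∑ p : Plaq (F.P K) 0,
                  (1 - reTr ((GaugeField.plaqHol U₀ p)⁻¹ * GaugeField.plaqHol (fun ℓ => expPoint (ζ ℓ) * U₀ ℓ : GaugeField (F.P K) 0 (Matrix.specialUnitaryGroup (Fin 2) ℂ)) p)) := by
    have h := le_trans (Finset.sum_nonneg fun p _ => sq_nonneg _) hJ0
    linarith
  have hC0 : 0 ≤ Real.exp Eε * (2 * Cst * (((5 ^ (F.P K).d : ℕ) : ℝ) ^ 2 * (((2 * (θr + 2) + 1) ^ (F.P K).d * 6 : ℕ) : ℝ) *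
              (2 * ((((F.P K).L ^ (F.P K).d : ℕ) : ℝ) - 1) / ((((F.P K).L ^ (F.P K).d : ℕ) : ℝ) - 3)))) :=
    mul_nonneg (Real.exp_nonneg _) (mul_nonneg (mul_nonneg zero_le_two hCst) hKL)
  have hRHS : 0 ≤ Real.exp Eε * (2 * Cst * (((5 ^ (F.P K).d : ℕ) : ℝ) ^ 2 * (((2 * (θr + 2) + 1) ^ (F.P K).d * 6 : ℕ) : ℝ) *
              (2 * ((((F.P K).L ^ (F.P K).d : ℕ) : ℝ) - 1) / ((((F.P K).L ^ (F.P K).d : ℕ) : ℝ) - 3)))) *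
      (4 * (F.L : ℝ)⁻¹ * ((F.L : ℝ) ^ (K - J) * ∑ p : Plaq (F.P K) 0,
                  (1 - reTr ((GaugeField.plaqHol U₀ p)⁻¹ * GaugeField.plaqHol (fun ℓ => expPoint (ζ ℓ) * U₀ ℓ : GaugeField (F.P K) 0 (Matrix.specialUnitaryGroup (Fin 2) ℂ)) p))) + W * Bsrc) :=
    mul_nonneg hC0 (add_nonneg (mul_nonneg (mul_nonneg (by norm_num) (inv_nonneg.2 hL0.le))
      (mul_nonneg (pow_nonneg hL0.le _) hREL)) (mul_nonneg hWnn hBnn))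
  rcases Nat.eq_zero_or_pos (K - J) with h0 | hN
  · have hr : Finset.range (K - J) = ∅ := by rw [h0]; rfl
    rw [hr, Finset.sum_empty]
    exact hRHS
  -- (A) reindex `t ↦ K − J − 1 − t`
  have hA : ∑ t ∈ Finset.range (K - J), (F.L : ℝ) ^ t * (fun t => Cst * ∑ B : PBond (F.P J) 0,
      ‖(fun p : Plaq (F.P K) (K - J - 1 - t) =>
        if ∃ z₀ : Site (F.P K) 0, (blockIter (K - J) z₀ = (bondShift (F.sitesPerDir_eq (m := F.m) (K := J) (j := 0) (m' := F.m) (K' := K) (j' := K - J) (by omega)) B).src ∨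
            blockIter (K - J) z₀ = (bondShift (F.sitesPerDir_eq (m := F.m) (K := J) (j := 0) (m' := F.m) (K' := K) (j' := K - J) (by omega)) B).tgt) ∧
            ∀ κ, (rel (blockIter (K - J - 1 - t) z₀) p.src κ).natAbs ≤ θr
        then dist1 ((GaugeField.plaqHol (Averaging.iter (fun k => BlockAveraging.blockAvg (P := F.P K) (j := k) ℰp) (K - J - 1 - t) U₀) p)⁻¹ *
          GaugeField.plaqHol (Averaging.iter (fun k => BlockAveraging.blockAvg (P := F.P K) (j := k) ℰp) (K - J - 1 - t)
            (fun ℓ => expPoint (ζ ℓ) * U₀ ℓ : GaugeField (F.P K) 0 (Matrix.specialUnitaryGroup (Fin 2) ℂ))) p)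
        else 0)‖ ^ 2) t =
      ∑ n ∈ Finset.range (K - J), (F.L : ℝ) ^ (K - J - 1 - n) * (Cst * ∑ B : PBond (F.P J) 0,
      ‖(fun p : Plaq (F.P K) n =>
        if ∃ z₀ : Site (F.P K) 0, (blockIter (K - J) z₀ = (bondShift (F.sitesPerDir_eq (m := F.m) (K := J) (j := 0) (m' := F.m) (K' := K) (j' := K - J) (by omega)) B).src ∨
            blockIter (K - J) z₀ = (bondShift (F.sitesPerDir_eq (m := F.m) (K := J) (j := 0) (m' := F.m) (K' := K) (j' := K - J) (by omega)) B).tgt) ∧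
            ∀ κ, (rel (blockIter n z₀) p.src κ).natAbs ≤ θr
        then dist1 ((GaugeField.plaqHol (Averaging.iter (fun k => BlockAveraging.blockAvg (P := F.P K) (j := k) ℰp) n U₀) p)⁻¹ *
          GaugeField.plaqHol (Averaging.iter (fun k => BlockAveraging.blockAvg (P := F.P K) (j := k) ℰp) n
            (fun ℓ => expPoint (ζ ℓ) * U₀ ℓ : GaugeField (F.P K) 0 (Matrix.specialUnitaryGroup (Fin 2) ℂ))) p)
        else 0)‖ ^ 2) := by
    rw [← Finset.sum_range_reflect (fun n => (F.L : ℝ) ^ (K - J - 1 - n) * (Cst * ∑ B : PBond (F.P J) 0,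
      ‖(fun p : Plaq (F.P K) n =>
        if ∃ z₀ : Site (F.P K) 0, (blockIter (K - J) z₀ = (bondShift (F.sitesPerDir_eq (m := F.m) (K := J) (j := 0) (m' := F.m) (K' := K) (j' := K - J) (by omega)) B).src ∨
            blockIter (K - J) z₀ = (bondShift (F.sitesPerDir_eq (m := F.m) (K := J) (j := 0) (m' := F.m) (K' := K) (j' := K - J) (by omega)) B).tgt) ∧
            ∀ κ, (rel (blockIter n z₀) p.src κ).natAbs ≤ θr
        then dist1 ((GaugeField.plaqHol (Averaging.iter (fun k => BlockAveraging.blockAvg (P := F.P K) (j := k) ℰp) n U₀) p)⁻¹ *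
          GaugeField.plaqHol (Averaging.iter (fun k => BlockAveraging.blockAvg (P := F.P K) (j := k) ℰp) n
            (fun ℓ => expPoint (ζ ℓ) * U₀ ℓ : GaugeField (F.P K) 0 (Matrix.specialUnitaryGroup (Fin 2) ℂ))) p)
        else 0)‖ ^ 2)) (K - J)]
    refine Finset.sum_congr rfl fun t ht => ?_
    rw [Finset.mem_range] at ht
    have ht' : K - J - 1 - (K - J - 1 - t) = t := by omega
    beta_reduce
    rw [ht']
  rw [hA]
  -- (B) read-cell selection per level and coarsest bond
  have hsel : ∀ (n : ℕ) (B : PBond (F.P J) 0), ∃ s : Fin (F.P K).d → Fin (F.P K).d → Site (F.P K) n,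
      (∀ μ ν, ∃ z₀ : Site (F.P K) 0, (blockIter (K - J) z₀ = (bondShift (F.sitesPerDir_eq (m := F.m) (K := J) (j := 0) (m' := F.m) (K' := K) (j' := K - J) (by omega)) B).src ∨
            blockIter (K - J) z₀ = (bondShift (F.sitesPerDir_eq (m := F.m) (K := J) (j := 0) (m' := F.m) (K' := K) (j' := K - J) (by omega)) B).tgt) ∧
            ∀ κ, (rel (blockIter n z₀) (s μ ν) κ).natAbs ≤ θr) ∧
      (n < K - J → ‖(fun p : Plaq (F.P K) n =>
        if ∃ z₀ : Site (F.P K) 0, (blockIter (K - J) z₀ = (bondShift (F.sitesPerDir_eq (m := F.m) (K := J) (j := 0) (m' := F.m) (K' := K) (j' := K - J) (by omega)) B).src ∨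
            blockIter (K - J) z₀ = (bondShift (F.sitesPerDir_eq (m := F.m) (K := J) (j := 0) (m' := F.m) (K' := K) (j' := K - J) (by omega)) B).tgt) ∧
            ∀ κ, (rel (blockIter n z₀) p.src κ).natAbs ≤ θr
        then dist1 ((GaugeField.plaqHol (Averaging.iter (fun k => BlockAveraging.blockAvg (P := F.P K) (j := k) ℰp) n U₀) p)⁻¹ *
          GaugeField.plaqHol (Averaging.iter (fun k => BlockAveraging.blockAvg (P := F.P K) (j := k) ℰp) n
            (fun ℓ => expPoint (ζ ℓ) * U₀ ℓ : GaugeField (F.P K) 0 (Matrix.specialUnitaryGroup (Fin 2) ℂ))) p)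
        else 0)‖ ^ 2 ≤ ∑ μ, ∑ ν, (if μ < ν then ρ μ ν n (s μ ν) else 0) ^ 2) := by
    intro n B
    obtain ⟨y, hy⟩ := readCell_nonempty F hJK θr B n
    by_cases hn : n < K - J
    · obtain ⟨s, hs1, hs2⟩ := exists_sel_sq_pi_norm_trunc_le (P := F.P K)
        (fun y : Site (F.P K) n => ∃ z₀ : Site (F.P K) 0, (blockIter (K - J) z₀ = (bondShift (F.sitesPerDir_eq (m := F.m) (K := J) (j := 0) (m' := F.m) (K' := K) (j' := K - J) (by omega)) B).src ∨
            blockIter (K - J) z₀ = (bondShift (F.sitesPerDir_eq (m := F.m) (K := J) (j := 0) (m' := F.m) (K' := K) (j' := K - J) (by omega)) B).tgt) ∧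
            ∀ κ, (rel (blockIter n z₀) y κ).natAbs ≤ θr) ⟨y, hy⟩
        (fun p : Plaq (F.P K) n => dist1 ((GaugeField.plaqHol (Averaging.iter (fun k => BlockAveraging.blockAvg (P := F.P K) (j := k) ℰp) n U₀) p)⁻¹ *
          GaugeField.plaqHol (Averaging.iter (fun k => BlockAveraging.blockAvg (P := F.P K) (j := k) ℰp) n
            (fun ℓ => expPoint (ζ ℓ) * U₀ ℓ : GaugeField (F.P K) 0 (Matrix.specialUnitaryGroup (Fin 2) ℂ))) p)) (fun p => GaugeGroup.dist1_nonneg _)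
        (fun μ ν y => if μ < ν then ρ μ ν n y else 0) (fun p => by rw [if_pos p.hμν]; exact hdom n hn p)
      exact ⟨s, hs1, fun _ => hs2⟩
    · obtain ⟨s, hs1, -⟩ := exists_sel_sq_pi_norm_trunc_le (P := F.P K)
        (fun y : Site (F.P K) n => ∃ z₀ : Site (F.P K) 0, (blockIter (K - J) z₀ = (bondShift (F.sitesPerDir_eq (m := F.m) (K := J) (j := 0) (m' := F.m) (K' := K) (j' := K - J) (by omega)) B).src ∨
            blockIter (K - J) z₀ = (bondShift (F.sitesPerDir_eq (m := F.m) (K := J) (j := 0) (m' := F.m) (K' := K) (j' := K - J) (by omega)) B).tgt) ∧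
            ∀ κ, (rel (blockIter n z₀) y κ).natAbs ≤ θr) ⟨y, hy⟩
        (fun _ : Plaq (F.P K) n => (0 : ℝ)) (fun _ => le_rfl)
        (fun μ ν y => if μ < ν then ρ μ ν n y else 0) (fun p => by rw [if_pos p.hμν]; exact hρ _ _ _ _)
      exact ⟨s, hs1, fun h => absurd h hn⟩
  choose sel hselA hselB using hsel
  -- (C) the selected values dominate; exchange the sums
  have hC : ∑ n ∈ Finset.range (K - J), (F.L : ℝ) ^ (K - J - 1 - n) * (Cst * ∑ B : PBond (F.P J) 0,
      ‖(fun p : Plaq (F.P K) n =>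
        if ∃ z₀ : Site (F.P K) 0, (blockIter (K - J) z₀ = (bondShift (F.sitesPerDir_eq (m := F.m) (K := J) (j := 0) (m' := F.m) (K' := K) (j' := K - J) (by omega)) B).src ∨
            blockIter (K - J) z₀ = (bondShift (F.sitesPerDir_eq (m := F.m) (K := J) (j := 0) (m' := F.m) (K' := K) (j' := K - J) (by omega)) B).tgt) ∧
            ∀ κ, (rel (blockIter n z₀) p.src κ).natAbs ≤ θr
        then dist1 ((GaugeField.plaqHol (Averaging.iter (fun k => BlockAveraging.blockAvg (P := F.P K) (j := k) ℰp) n U₀) p)⁻¹ *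
          GaugeField.plaqHol (Averaging.iter (fun k => BlockAveraging.blockAvg (P := F.P K) (j := k) ℰp) n
            (fun ℓ => expPoint (ζ ℓ) * U₀ ℓ : GaugeField (F.P K) 0 (Matrix.specialUnitaryGroup (Fin 2) ℂ))) p)
        else 0)‖ ^ 2) ≤
      ∑ μ, ∑ ν, ∑ n ∈ Finset.range (K - J + 1), (if n < K - J then Cst * (F.L : ℝ) ^ (K - J - 1 - n) else 0) *
        ∑ B : PBond (F.P J) 0, (if μ < ν then ρ μ ν n (sel n B μ ν) else 0) ^ 2 := by
    calc ∑ n ∈ Finset.range (K - J), (F.L : ℝ) ^ (K - J - 1 - n) * (Cst * ∑ B : PBond (F.P J) 0,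
      ‖(fun p : Plaq (F.P K) n =>
        if ∃ z₀ : Site (F.P K) 0, (blockIter (K - J) z₀ = (bondShift (F.sitesPerDir_eq (m := F.m) (K := J) (j := 0) (m' := F.m) (K' := K) (j' := K - J) (by omega)) B).src ∨
            blockIter (K - J) z₀ = (bondShift (F.sitesPerDir_eq (m := F.m) (K := J) (j := 0) (m' := F.m) (K' := K) (j' := K - J) (by omega)) B).tgt) ∧
            ∀ κ, (rel (blockIter n z₀) p.src κ).natAbs ≤ θr
        then dist1 ((GaugeField.plaqHol (Averaging.iter (fun k => BlockAveraging.blockAvg (P := F.P K) (j := k) ℰp) n U₀) p)⁻¹ *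
          GaugeField.plaqHol (Averaging.iter (fun k => BlockAveraging.blockAvg (P := F.P K) (j := k) ℰp) n
            (fun ℓ => expPoint (ζ ℓ) * U₀ ℓ : GaugeField (F.P K) 0 (Matrix.specialUnitaryGroup (Fin 2) ℂ))) p)
        else 0)‖ ^ 2)
        ≤ ∑ n ∈ Finset.range (K - J), (F.L : ℝ) ^ (K - J - 1 - n) * (Cst * ∑ B : PBond (F.P J) 0,
            ∑ μ, ∑ ν, (if μ < ν then ρ μ ν n (sel n B μ ν) else 0) ^ 2) :=
          Finset.sum_le_sum fun n hn => mul_le_mul_of_nonneg_left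
            (mul_le_mul_of_nonneg_left (Finset.sum_le_sum fun B _ => hselB n B (Finset.mem_range.1 hn)) hCst) (pow_nonneg hL0.le _)
      _ = ∑ n ∈ Finset.range (K - J), (if n < K - J then Cst * (F.L : ℝ) ^ (K - J - 1 - n) else 0) *
            ∑ B : PBond (F.P J) 0, ∑ μ, ∑ ν, (if μ < ν then ρ μ ν n (sel n B μ ν) else 0) ^ 2 :=
          Finset.sum_congr rfl fun n hn => by rw [if_pos (Finset.mem_range.1 hn)]; ring
      _ = ∑ n ∈ Finset.range (K - J + 1), (if n < K - J then Cst * (F.L : ℝ) ^ (K - J - 1 - n) else 0) *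
            ∑ B : PBond (F.P J) 0, ∑ μ, ∑ ν, (if μ < ν then ρ μ ν n (sel n B μ ν) else 0) ^ 2 := by
          rw [Finset.sum_range_succ, if_neg (lt_irrefl _), zero_mul, add_zero]
      _ = _ := by
          simp_rw [Finset.mul_sum]
          refine Eq.trans (Finset.sum_congr rfl fun n _ => Finset.sum_comm) ?_
          refine Eq.trans (Finset.sum_congr rfl fun n _ => Finset.sum_congr rfl fun μ _ => Finset.sum_comm) ?_
          refine Eq.trans Finset.sum_comm ?_
          exact Finset.sum_congr rfl fun μ _ => Finset.sum_comm
  -- (D) the engine over all orientations; (E) the finest junction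
  have hD := weighted_orient_sum_le F hJK θr Cst hCst w hw W hW ρ src ε hρ hsrc hε hrow sel hselA
  have hE0 : ∑ μ, ∑ ν, (if μ < ν then ∑ z : Site (F.P K) 0, ρ μ ν 0 z ^ 2 else 0) ≤ 4 * ∑ p : Plaq (F.P K) 0,
                  (1 - reTr ((GaugeField.plaqHol U₀ p)⁻¹ * GaugeField.plaqHol (fun ℓ => expPoint (ζ ℓ) * U₀ ℓ : GaugeField (F.P K) 0 (Matrix.specialUnitaryGroup (Fin 2) ℂ)) p)) := by
    rw [← sum_plaq_eq_sum_ite (fun z μ ν => ρ μ ν 0 z ^ 2)]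
    exact le_trans (Finset.sum_le_sum fun p _ => pow_le_pow_left₀ (hρ _ _ _ _) (hdom0 p) 2) hJ0
  -- (F) assemble
  have hexp : Real.exp (2 * ∑ j ∈ Finset.range (K - J), ε j) ≤ Real.exp Eε := Real.exp_le_exp.2 hEε
  have hLpow : (F.L : ℝ) ^ (K - J - 1) = (F.L : ℝ)⁻¹ * (F.L : ℝ) ^ (K - J) := by
    obtain ⟨m, hm⟩ : ∃ m, K - J = m + 1 := ⟨K - J - 1, by omega⟩
    rw [hm, Nat.add_sub_cancel, pow_succ]
    field_simp
  have h1 : 0 ≤ (F.L : ℝ) ^ (K - J - 1) * (4 * ∑ p : Plaq (F.P K) 0,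
                  (1 - reTr ((GaugeField.plaqHol U₀ p)⁻¹ * GaugeField.plaqHol (fun ℓ => expPoint (ζ ℓ) * U₀ ℓ : GaugeField (F.P K) 0 (Matrix.specialUnitaryGroup (Fin 2) ℂ)) p))) + W * Bsrc :=
    add_nonneg (mul_nonneg (pow_nonneg hL0.le _) (mul_nonneg (by norm_num) hREL)) (mul_nonneg hWnn hBnn)
  have h2 : (F.L : ℝ) ^ (K - J - 1) * ∑ μ, ∑ ν, (if μ < ν then ∑ z : Site (F.P K) 0, ρ μ ν 0 z ^ 2 else 0) +
        W * ∑ j ∈ Finset.Icc 1 (K - J), w j * (F.L : ℝ) ^ (K - J - 1 - j) *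
          ∑ μ : Fin (F.P K).d, ∑ ν : Fin (F.P K).d, ∑ c : Site (F.P K) j, src μ ν j c ^ 2 ≤
      (F.L : ℝ) ^ (K - J - 1) * (4 * ∑ p : Plaq (F.P K) 0,
                  (1 - reTr ((GaugeField.plaqHol U₀ p)⁻¹ * GaugeField.plaqHol (fun ℓ => expPoint (ζ ℓ) * U₀ ℓ : GaugeField (F.P K) 0 (Matrix.specialUnitaryGroup (Fin 2) ℂ)) p))) + W * Bsrc :=
    add_le_add (mul_le_mul_of_nonneg_left hE0 (pow_nonneg hL0.le _)) (mul_le_mul_of_nonneg_left hBsrc hWnn)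
  calc _ ≤ _ := hC
    _ ≤ _ := hD
    _ ≤ Real.exp (2 * ∑ j ∈ Finset.range (K - J), ε j) * (2 * Cst * (((5 ^ (F.P K).d : ℕ) : ℝ) ^ 2 * (((2 * (θr + 2) + 1) ^ (F.P K).d * 6 : ℕ) : ℝ) *
              (2 * ((((F.P K).L ^ (F.P K).d : ℕ) : ℝ) - 1) / ((((F.P K).L ^ (F.P K).d : ℕ) : ℝ) - 3)))) *
          ((F.L : ℝ) ^ (K - J - 1) * (4 * ∑ p : Plaq (F.P K) 0,
                  (1 - reTr ((GaugeField.plaqHol U₀ p)⁻¹ * GaugeField.plaqHol (fun ℓ => expPoint (ζ ℓ) * U₀ ℓ : GaugeField (F.P K) 0 (Matrix.specialUnitaryGroup (Fin 2) ℂ)) p))) + W * Bsrc) :=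
        mul_le_mul_of_nonneg_left h2 (mul_nonneg (Real.exp_nonneg _) (mul_nonneg (mul_nonneg zero_le_two hCst) hKL))
    _ ≤ Real.exp Eε * (2 * Cst * (((5 ^ (F.P K).d : ℕ) : ℝ) ^ 2 * (((2 * (θr + 2) + 1) ^ (F.P K).d * 6 : ℕ) : ℝ) *
              (2 * ((((F.P K).L ^ (F.P K).d : ℕ) : ℝ) - 1) / ((((F.P K).L ^ (F.P K).d : ℕ) : ℝ) - 3)))) * ((F.L : ℝ) ^ (K - J - 1) * (4 * ∑ p : Plaq (F.P K) 0,
                  (1 - reTr ((GaugeField.plaqHol U₀ p)⁻¹ * GaugeField.plaqHol (fun ℓ => expPoint (ζ ℓ) * U₀ ℓ : GaugeField (F.P K) 0 (Matrix.specialUnitaryGroup (Fin 2) ℂ)) p))) + W * Bsrc) :=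
        mul_le_mul_of_nonneg_right (mul_le_mul_of_nonneg_right hexp (mul_nonneg (mul_nonneg zero_le_two hCst) hKL)) h1
    _ = _ := by rw [hLpow]; ring

/-- ★★ **THE c₁ BUDGET CORE AT THE GEOMETRIC WEIGHTS `w_j = 2^j`, `W = 1`** (✓`sum_Icc_inv_two_pow_le_one`). [cite: Balaban1985Averaging, Prop. 4 (128)-(135) pp.37-38; Balaban1987RG1, (0.11) p.253] -/
theorem curlBudget_core_two_pow {J K : ℕ} (hJK : J ≤ K) (θr : ℕ) (Cst : ℝ) (hCst : 0 ≤ Cst)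
    (U₀ : GaugeField (F.P K) 0 (Matrix.specialUnitaryGroup (Fin 2) ℂ)) (ζ : PBond (F.P K) 0 → EuclideanSpace ℝ (Fin 3))
    (ρ src : Fin (F.P K).d → Fin (F.P K).d → (i : ℕ) → Site (F.P K) i → ℝ) (ε : ℕ → ℝ)
    (hρ : ∀ μ ν i x, 0 ≤ ρ μ ν i x) (hsrc : ∀ μ ν i x, 0 ≤ src μ ν i x) (hε : ∀ j, 0 ≤ ε j)
    (hdom : ∀ n, n < K - J → ∀ p : Plaq (F.P K) n,
      dist1 ((GaugeField.plaqHol (Averaging.iter (fun k => BlockAveraging.blockAvg (P := F.P K) (j := k) ℰp) n U₀) p)⁻¹ *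
          GaugeField.plaqHol (Averaging.iter (fun k => BlockAveraging.blockAvg (P := F.P K) (j := k) ℰp) n
            (fun ℓ => expPoint (ζ ℓ) * U₀ ℓ : GaugeField (F.P K) 0 (Matrix.specialUnitaryGroup (Fin 2) ℂ))) p) ≤ ρ p.μ p.ν n p.src)
    (hdom0 : ∀ p : Plaq (F.P K) 0, ρ p.μ p.ν 0 p.src ≤
      dist1 ((GaugeField.plaqHol U₀ p)⁻¹ * GaugeField.plaqHol (fun ℓ => expPoint (ζ ℓ) * U₀ ℓ : GaugeField (F.P K) 0 (Matrix.specialUnitaryGroup (Fin 2) ℂ)) p))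
    (hrow : ∀ μ ν, μ < ν → ∀ i, i < K - J → ∀ y' : Site (F.P K) (i + 1),
        ρ μ ν (i + 1) y' ≤ (1 + ε i) * ((Fintype.card (Idx (F.P K)) : ℝ)⁻¹ *
            ∑ a ∈ (Finset.univ : Finset (Idx (F.P K))) ×ˢ (Finset.range (F.P K).L ×ˢ Finset.range (F.P K).L),
              ρ μ ν i (shiftN (shiftN (Site.blockSite y' a.1.1) μ a.2.1) ν a.2.2)) +
          src μ ν (i + 1) y')
    (Eε : ℝ) (hEε : 2 * ∑ j ∈ Finset.range (K - J), ε j ≤ Eε) (Bsrc : ℝ)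
    (hBsrc : ∑ j ∈ Finset.Icc 1 (K - J), (2 : ℝ) ^ j * (F.L : ℝ) ^ (K - J - 1 - j) *
        ∑ μ : Fin (F.P K).d, ∑ ν : Fin (F.P K).d, ∑ c : Site (F.P K) j, src μ ν j c ^ 2 ≤ Bsrc) :
    ∑ t ∈ Finset.range (K - J), (F.L : ℝ) ^ t * (fun t => Cst * ∑ B : PBond (F.P J) 0,
      ‖(fun p : Plaq (F.P K) (K - J - 1 - t) =>
        if ∃ z₀ : Site (F.P K) 0, (blockIter (K - J) z₀ = (bondShift (F.sitesPerDir_eq (m := F.m) (K := J) (j := 0) (m' := F.m) (K' := K) (j' := K - J) (by omega)) B).src ∨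
            blockIter (K - J) z₀ = (bondShift (F.sitesPerDir_eq (m := F.m) (K := J) (j := 0) (m' := F.m) (K' := K) (j' := K - J) (by omega)) B).tgt) ∧
            ∀ κ, (rel (blockIter (K - J - 1 - t) z₀) p.src κ).natAbs ≤ θr
        then dist1 ((GaugeField.plaqHol (Averaging.iter (fun k => BlockAveraging.blockAvg (P := F.P K) (j := k) ℰp) (K - J - 1 - t) U₀) p)⁻¹ *
          GaugeField.plaqHol (Averaging.iter (fun k => BlockAveraging.blockAvg (P := F.P K) (j := k) ℰp) (K - J - 1 - t)
            (fun ℓ => expPoint (ζ ℓ) * U₀ ℓ : GaugeField (F.P K) 0 (Matrix.specialUnitaryGroup (Fin 2) ℂ))) p)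
        else 0)‖ ^ 2) t ≤
      Real.exp Eε * (2 * Cst * (((5 ^ (F.P K).d : ℕ) : ℝ) ^ 2 * (((2 * (θr + 2) + 1) ^ (F.P K).d * 6 : ℕ) : ℝ) *
              (2 * ((((F.P K).L ^ (F.P K).d : ℕ) : ℝ) - 1) / ((((F.P K).L ^ (F.P K).d : ℕ) : ℝ) - 3)))) *
        (4 * (F.L : ℝ)⁻¹ * ((F.L : ℝ) ^ (K - J) * ∑ p : Plaq (F.P K) 0,
                  (1 - reTr ((GaugeField.plaqHol U₀ p)⁻¹ * GaugeField.plaqHol (fun ℓ => expPoint (ζ ℓ) * U₀ ℓ : GaugeField (F.P K) 0 (Matrix.specialUnitaryGroup (Fin 2) ℂ)) p))) + 1 * Bsrc) :=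
  curlBudget_core F hJK θr Cst hCst U₀ ζ (fun j => (2 : ℝ) ^ j) (fun j => by positivity) 1
    (fun n => by simpa only [one_div] using sum_Icc_inv_two_pow_le_one n)
    ρ src ε hρ hsrc hε hdom hdom0 hrow Eε hEε Bsrc hBsrc

end Summit.QuantumFields.YangMills.Theorems.FluctuationComparisonRegPrIntLS2BetaCurlBudget

end
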